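import Mathlib
import Summits.NavierStokesRegularity.NavierStokesRegularity.Theorems.ThreadingFluxHorizonTowerQuadraticGeneratorZonalExit
import Summits.NavierStokesRegularity.NavierStokesRegularity.Theorems.ThreadingFluxHorizonTowerQuadraticGeneratorCone
import Summits.NavierStokesRegularity.NavierStokesRegularity.Theorems.ThreadingFluxHorizonTowerQuadraticGeneratorConfinement
import Summits.NavierStokesRegularity.NavierStokesRegularity.Theorems.ThreadingFluxHorizonTowerFiniteTowerTopPairSplit3
import Summits.NavierStokesRegularity.NavierStokesRegularity.Theorems.ThreadingFluxHorizonTowerThirdDigit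
import HarnessLib

/-!
# Crux `PoloidalLiouville` (stmt-NavierStokesRegularity-1222), crux idea «horizon-threading-tower» (ns-idea-15):
# FINITE TOWERS AT ORDER ONE — THM J: THE THIRD CONE DIGIT IN GENERAL DEGREE (gcd-2 top pair WITH the competitor shell)

Support file (`--supports stmt-NavierStokesRegularity-1222`, helper; cell `ns-wall-extremal`, width hand ns-wall-eng-3 g6; 0 kit).

★★ THM J `finiteTower_zonal_of_gcdTwoCompetitor`: a scale-free FINITE tower `Σ_{l∈K} U_{H_l}` of horizon profiles of smooth homogeneous
harmonic shells (degrees `≥ 1`) annihilated by the order-one horizon law off the centre, whose two largest degrees are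
`D′ = 2(m+2) < D = 2(n+2)` with `m + 2 ⊥ n + 2` (so `gcd(D′, D) = 2`), with `H_D, H_{D′} ≢ 0`, the COMPETITOR shell of degree `D′ − 2` and
every lower shell of either parity FREE, and no shell of degree `D′ − 4` unless that degree is `≤ 2` (`∀ l ∈ K, l + 4 = D′ → l ≤ 2`), is
COAXIALLY ZONAL.  This is THM H (`…FiniteTowerEvenPair`, p716034) WITHOUT its gap hypothesis `∀ l ∈ K, l + 2 ≠ D′`; it contains THM E
(`{2,4,6}`), THM G (`{4,6,8}`), THM I (`{2,4,6,8}`) and decides `{2,4,10}`, `{4,6,10}`, `{2,4,6,10}`, `{6,8,10}`, `{2,6,8,10}`, `{8,10,12}`,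
`{6,8,14}`, … (with any odd / lower shells).
PROOF.  Digits 0–1 as THM H: `P_{D′} = g₁L^{m+2} + ρG₁`, `P_D = g₂L^{n+2} + ρG₂` over ONE real quadratic generator `L = xᵀQx`.  The class
identity split to level `N − 4` (`…TopPairSplit3`): `c₀{P_{D′},P_D} + ρc₁{P_c,P_D} + ρ²(c_b{P_b,P_D} + e{P_c,P_{D′}}) + ρ³R = 0`.
DIGIT 2: with the second digit of `{P_{D′},P_D}` (`…SecondDigit`) the `ρ¹`-level reads `L^{n+1}{u·P_c − κ₁L^mM, L} ≡ 0 (mod ρ)`, so by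
CONFINEMENT (`…QuadraticGeneratorConfinement`) `u·P_c = κ₀L^{m+1} + κ₁L^mM + ρG_c` (`u ≠ 0`, `κ₁ ∝ g₁g₂`).  DIGIT 3 (`…ThirdDigit`, all
Leibniz closed forms in general degree, denominators cleared, everything multiplied by `L²`):
`K_M · L^{m+n+1}·M·W + L^{m+n+2}·Z ≡ 0 (mod ρ)` with `K_M = 4096·c₀c₁(8m+14)(8n+14)(m+2)(n+2)²·g₁g₂²·N(m,n)`,
`N(m,n) = 144m⁴n + 180m⁴ + 612m³n + 675m³ − 144m²n³ − 180m²n² + 1350m²n + 1350m² − 612mn³ − 1395mn² + 540mn + 1260m − 630n³ − 1890n² − 1260n`,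
and `N(m, m+d+1) = −(d+1)(288m⁴ + 432m³d + 2016m³ + 144m²d² + 2304m²d + 5490m² + 612md² + 4509md + 7137m + 630d² + 3150d + 3780) < 0`,
so `K_M ≠ 0`; on the null cone `chartT L ∣ K_M · chartT W · chartT M`, impossible off the uniaxial locus by the COPRIMALITY OF THE
GENERATOR CHARTS (`Zonal.eq_zero_of_chartT_genL_dvd`, `…QuadraticGeneratorCone`); so `W = det(x,Qx,Q²x) ≡ 0`, `{L, M₀} = 0`, same-degree
rigidity, `Q² = βQ + γI`, the uniaxial lemma, and THM A descends.  (The shell of degree `D′ − 4` enters digit 3 as `L^{n+1}{P_{D′−4}, L}`,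
absorbed by `L^{m+n+2}` exactly when `m ≤ 1`; for `m ≥ 2` it is confined, not killed, and the decision moves to digit 4 — not here.)

HONEST LABEL: an infinite family of cells of the crux-idea CONJECTURE `HorizonTowerZonality` at ORDER ONE (information-grade); towers with
`gcd ≥ 3` on the top pair, `gcd = 2` with BOTH the `D′−2` and `D′−4` shells (`m ≥ 2`), ties, general towers, `PoloidalLiouville` (1222),
`UnthreadedRigidity` (27585) OPEN; W1 movement 0; NS regularity NOT proved.  [folklore]
-/

-- the summit and its single sub-problem share the name (CONVENTIONS §1)
set_option linter.dupNamespace false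
-- `simp only` closers over `C`-coefficients are import-order sensitive (simprocs); keep the lists explicit, silence the arg linter
set_option linter.unusedSimpArgs false

noncomputable section

open MvPolynomial Complex
open scoped Polynomial RealInnerProductSpace
open Literature.Analysis.FluidPDE (cross)

namespace Summit.NavierStokesRegularity.NavierStokesRegularity.Theorems.PoloidalLiouville.HorizonTower

section FiniteTower

variable (K : Finset ℕ) (H : ℕ → E3 → ℝ)

set_option maxHeartbeats 1600000 in
/-- ★★ **THM J, polynomial level.**  In a finite tower passing order one with top pair `D′ = 2(m+2) < D = 2(n+2)`, `m+2 ⊥ n+2`,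
`P_D, P_{D′} ≠ 0`, the competitor shell of degree `D′ − 2` free and no shell of degree `D′ − 4` unless that degree is `≤ 2`, the top shell is
annihilated by the rotation derivative about a real axis. [folklore] -/
theorem finiteTower_exists_axis_of_gcdTwoCompetitor (hK : ∀ l ∈ K, 1 ≤ l) (hH : ∀ l ∈ K, ContDiff ℝ (⊤ : ℕ∞) (H l))
    (hhom : ∀ l ∈ K, ∀ (c : ℝ) (y : E3), H l (c • y) = c ^ l * H l y)
    (hharm : ∀ l ∈ K, ∀ y, Laplacian.laplacian (H l) y = 0)
    (hL1 : ∀ x : E3, x ≠ 0 → horizonL1 (fun z => ∑ l ∈ K, horizonProfile l (H l) 0 z) 0 x = 0)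
    (P : ℕ → MvPolynomial (Fin 3) ℝ)
    (hP : ∀ l ∈ K, (P l).IsHomogeneous l ∧ Zonal.lapP (P l) = 0 ∧ ∀ y, H l y = Zonal.evalE (P l) y)
    {m n : ℕ} (hmn : m < n) (hcop : (m + 2).Coprime (n + 2)) (hD : 2 * (n + 2) ∈ K) (hD' : 2 * (m + 2) ∈ K)
    (hmax : ∀ l ∈ K, l ≤ 2 * (n + 2)) (hsec : ∀ l ∈ K, l ≠ 2 * (n + 2) → l ≤ 2 * (m + 2))
    (hgap4 : ∀ l ∈ K, l + 4 = 2 * (m + 2) → l ≤ 2) (hPD : P (2 * (n + 2)) ≠ 0) (hPD' : P (2 * (m + 2)) ≠ 0) :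
    ∃ v : Fin 3 → ℝ, v ≠ 0 ∧ Zonal.detP (C (v 0) * X 0 + C (v 1) * X 1 + C (v 2) * X 2) (P (2 * (n + 2))) = 0 := by
  classical
  set D : ℕ := 2 * (n + 2) with hDdef
  set D' : ℕ := 2 * (m + 2) with hD'def
  have hlt : D' < D := by omega
  have hρ0 : (Zonal.normSq : Zonal.RPoly) ≠ 0 := Zonal.rho_ne_zero
  obtain ⟨hPDh, hPDl, hPDe⟩ := hP D hD
  obtain ⟨hPD'h, hPD'l, hPD'e⟩ := hP D' hD'
  -- (0) the class identity split to level `N − 4`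
  obtain ⟨e, R, he, hE⟩ := finiteTower_topPair_mod_normSq_cube K H hK hH hhom hharm hL1 P (fun l hl => (hP l hl).2.2) hD hD'
    (by omega) (by omega) (show 2 * m + 2 + 2 = D' by omega) (show 2 * m + 4 = D' by omega) hmax hsec
  set Pc : Zonal.RPoly := if 2 * m + 2 ∈ K then P (2 * m + 2) else 0 with hPcdef
  set Pb : Zonal.RPoly := if 2 * m ∈ K then P (2 * m) else 0 with hPbdef
  have hdet0 : ∀ Q : Zonal.RPoly, Zonal.detP 0 Q = 0 := fun Q => by rw [← C_0, Zonal.detP_C_left, C_0]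
  have hPch : Pc.IsHomogeneous (2 * (m + 1)) := by
    rw [hPcdef]
    split_ifs with h
    · rw [show 2 * (m + 1) = 2 * m + 2 by ring]; exact (hP _ h).1
    · exact isHomogeneous_zero _ _ _
  have hPcl : Zonal.lapP Pc = 0 := by
    rw [hPcdef]
    split_ifs with h
    · exact (hP _ h).2.1
    · have h0 := Zonal.lapP_C' (0 : ℝ); rwa [C_0] at h0
  -- the shell of degree `D′ − 4 = 2m` is present only when `m = 1` (`m = 0`: degree `0 ∉ K`; `m ≥ 2`: excluded)
  have hPbZ : ∀ Y : Zonal.RPoly, Y ^ (n + 3) * Zonal.detP Pb Y = Y ^ (m + n + 2) * (if m = 1 then Zonal.detP Pb Y else 0) := by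
    intro Y
    by_cases hb : 2 * m ∈ K
    · have h1 : 2 * m ≤ 2 := hgap4 _ hb (by omega)
      have h2 : 1 ≤ 2 * m := hK _ hb
      have hm : m = 1 := by omega
      rw [if_pos hm, show n + 3 = m + n + 2 by omega]
    · rw [hPbdef, if_neg hb, hdet0]
      split_ifs <;> simp
  -- (1) the null-cone digit: weighted Wronskian law of the top pair (as THM H)
  set f : ℂ[X] := Zonal.chartT (map (algebraMap ℝ ℂ) (P D')) with hf
  set g : ℂ[X] := Zonal.chartT (map (algebraMap ℝ ℂ) (P D)) with hg
  have hW := finiteTower_top_wronskian K H hK hH hhom hharm hL1 P (fun l hl => ⟨(hP l hl).1, (hP l hl).2.2⟩) hD hD' hlt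
    hmax hsec
  rw [← hf, ← hg] at hW
  have hW' : ((m + 2 : ℕ) : ℂ[X]) * f * Polynomial.derivative g = ((n + 2 : ℕ) : ℂ[X]) * g * Polynomial.derivative f := by
    have h2 : (2 : ℂ[X]) * (((m + 2 : ℕ) : ℂ[X]) * f * Polynomial.derivative g - ((n + 2 : ℕ) : ℂ[X]) * g * Polynomial.derivative f)
        = 0 := by
      rw [hDdef, hD'def] at hW; push_cast at hW ⊢; linear_combination hW
    exact sub_eq_zero.mp ((mul_eq_zero.mp h2).resolve_left two_ne_zero)
  have hWr := Zonal.wronskian_pow_pow_eq_zero (a := m + 2) (b := n + 2) (by omega) (by omega) hW'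
  have hg0 : g ≠ 0 := fun h => hPD (Zonal.eq_zero_of_chartT_map_eq_zero hPDh hPDl h)
  have hf0 : f ≠ 0 := fun h => hPD' (Zonal.eq_zero_of_chartT_map_eq_zero hPD'h hPD'l h)
  obtain ⟨c, hc⟩ := Zonal.exists_C_mul_of_wronskian_eq_zero (pow_ne_zero _ hg0) hWr
  set lc : ℂ := g.leadingCoeff with hlc
  obtain ⟨q, hqm, hgq, hdeg⟩ := Zonal.exists_monic_eq_C_mul_pow_of_coprime (a := n + 2) (b := m + 2) hcop.symm (by omega) hf0 hc
  rw [← hlc] at hgq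
  have hq0 : q ≠ 0 := hqm.ne_zero
  have hq4 : q.natDegree ≤ 4 := by
    have h1 : g.natDegree ≤ 2 * D := Zonal.natDegree_chartT_le (hPDh.map (algebraMap ℝ ℂ))
    have h2 : (n + 2) * q.natDegree ≤ (n + 2) * 4 := by rw [hdeg]; rw [hDdef] at h1; linarith
    exact Nat.le_of_mul_le_mul_left h2 (by omega)
  have hfp : f ^ (n + 2) = Polynomial.C (c * lc ^ (m + 2)) * (q ^ (m + 2)) ^ (n + 2) := by
    rw [hc, hgq, mul_pow, ← Polynomial.C_pow, ← mul_assoc, ← Polynomial.C_mul, ← pow_mul, ← pow_mul, mul_comm (n + 2)]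
  obtain ⟨γ, hγ⟩ := Zonal.exists_eq_C_mul_pow_of_pow_eq (D := n + 2) (d := m + 2) (by omega) hq0 hfp
  -- (2) the quadratic generator and its reality
  obtain ⟨qa, qb, qd, qe, qf, hgen⟩ := Zonal.exists_gen_chartT_eq hq4
  rw [← hgen] at hγ hgq
  obtain ⟨w, ra, rb, rd, re, rf, hwa, hwb, hwd, hwe, hwf⟩ :=
    Zonal.exists_real_gen_of_chartT_map_eq_pow hPDh hPDl hPD (by omega : 1 ≤ n + 2) hDdef hgq
  rw [hwa, hwb, hwd, hwe, hwf] at hγ hgq hgen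
  set L := Zonal.genL ra rb rd re rf with hLdef
  set M := Zonal.genM ra rb rd re rf with hMdef
  set W := Zonal.genW ra rb rd re rf with hWdef
  have hmapL : map (algebraMap ℝ ℂ) L = Zonal.genL (ra : ℂ) rb rd re rf := by rw [hLdef, Zonal.map_genL]; rfl
  have hchartw : Zonal.chartT (Zonal.genL (w * ra) (w * rb) (w * rd) (w * re) (w * rf))
      = Polynomial.C w * Zonal.chartT (map (algebraMap ℝ ℂ) L) := by
    rw [Zonal.genL_smul, Zonal.chartT_mul, Zonal.chartT_C, hmapL]
  rw [hchartw, mul_pow, ← Polynomial.C_pow, ← mul_assoc, ← Polynomial.C_mul] at hγ hgq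
  have hL0 : L ≠ 0 := by
    intro h0; apply hq0
    rw [← hgen, hchartw, h0, map_zero, Zonal.chartT_zero, mul_zero]
  -- (3) real coefficients and remainders
  obtain ⟨g₂, G₂, hG₂, hPDeq⟩ := Zonal.exists_coeff_remainder_of_chartT_map_eq_pow hPDh hDdef hL0 hgq
  obtain ⟨g₁, G₁, hG₁, hPD'eq⟩ := Zonal.exists_coeff_remainder_of_chartT_map_eq_pow hPD'h hD'def hL0 hγ
  have hG₂' : G₂.IsHomogeneous (2 * n + 2) := by rw [show 2 * n + 2 = 2 * (n + 2) - 2 by omega]; exact hG₂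
  have hG₁' : G₁.IsHomogeneous (2 * m + 2) := by rw [show 2 * m + 2 = 2 * (m + 2) - 2 by omega]; exact hG₁
  have hLc : Zonal.chartT (map (algebraMap ℝ ℂ) L) ≠ 0 := fun h0 =>
    hL0 (Zonal.eq_zero_of_chartT_map_eq_zero (Zonal.isHomogeneous_genL ra rb rd re rf) (Zonal.lapP_genL ra rb rd re rf) h0)
  have hchartPD : Zonal.chartT (map (algebraMap ℝ ℂ) (P D))
      = Polynomial.C ((g₂ : ℝ) : ℂ) * Zonal.chartT (map (algebraMap ℝ ℂ) L) ^ (n + 2) := by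
    rw [hPDeq, map_add, map_mul, map_C, map_pow, map_mul, Zonal.map_normSq, Zonal.chartT_add, Zonal.chartT_mul, Zonal.chartT_C,
      Zonal.chartT_pow, Zonal.chartT_mul, Zonal.chartT_normSq, zero_mul, add_zero]
    rfl
  have hg₂0 : g₂ ≠ 0 := by
    rintro rfl
    apply hg0
    rw [hg, hchartPD]; simp
  have hg₁0 : g₁ ≠ 0 := by
    rintro rfl
    apply hf0
    rw [hf, hPD'eq, map_add, map_mul, map_C, map_pow, map_mul, Zonal.map_normSq, Zonal.chartT_add, Zonal.chartT_mul,
      Zonal.chartT_C, Zonal.chartT_pow, Zonal.chartT_mul, Zonal.chartT_normSq, zero_mul, add_zero]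
    simp
  -- the harmonic remainders and the second digit
  have hr₁ := Zonal.remainder_of_harmonic ra rb rd re rf hG₁' hPD'eq hPD'l
  have hr₂ := Zonal.remainder_of_harmonic ra rb rd re rf hG₂' hPDeq hPDl
  have hr₁' : C (8 * (m : ℝ) + 14) * G₁ = C (-(4 * ((m : ℝ) + 2) * ((m : ℝ) + 1) * g₁)) * L ^ m * M - Zonal.normSq * Zonal.lapP G₁ := by
    rw [hr₁, map_neg]; ring
  have hr₂' : C (8 * (n : ℝ) + 14) * G₂ = C (-(4 * ((n : ℝ) + 2) * ((n : ℝ) + 1) * g₂)) * L ^ n * M - Zonal.normSq * Zonal.lapP G₂ := by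
    rw [hr₂, map_neg]; ring
  have h2 := Zonal.secondDigit_detP ra rb rd re rf hG₁' hG₂' hPD'eq hPDeq hPD'l hPDl
  -- the coefficients of the class identity (kept opaque)
  obtain ⟨c₀, hc₀⟩ : ∃ c₀ : ℝ, c₀ = 2 * ((D' : ℝ) * (D' + 1) - (D : ℝ) * (D + 1)) := ⟨_, rfl⟩
  obtain ⟨c₁, hc₁⟩ : ∃ c₁ : ℝ, c₁ = 2 * (((2 * m + 2 : ℕ) : ℝ) * ((2 * m + 2 : ℕ) + 1) - (D : ℝ) * (D + 1)) := ⟨_, rfl⟩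
  obtain ⟨cb, hcb⟩ : ∃ cb : ℝ, cb = 2 * (((2 * m : ℕ) : ℝ) * ((2 * m : ℕ) + 1) - (D : ℝ) * (D + 1)) := ⟨_, rfl⟩
  rw [← hc₀, ← hc₁, ← hcb] at hE
  have hc₀0 : c₀ ≠ 0 := by
    rw [hc₀]; exact mul_ne_zero two_ne_zero (mul_succ_ne_of_ne (l := D') (m := D) hlt.ne)
  have hc₁0 : c₁ ≠ 0 := by
    rw [hc₁]; exact mul_ne_zero two_ne_zero (mul_succ_ne_of_ne (l := 2 * m + 2) (m := D) (by omega))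
  -- (4) DIGIT 2: the competitor is CONFINED
  -- combine the class identity with the second digit and cancel one `ρ`
  have hcomb1 : Zonal.normSq * (C (c₀ * (96 * ((m : ℝ) + 2) * ((n : ℝ) + 2) * ((m : ℝ) - n) * g₁ * g₂)) * L ^ (m + n + 1) * W
      + C (c₁ * ((8 * (m : ℝ) + 14) * (8 * (n : ℝ) + 14))) * Zonal.detP Pc (P D)
      + Zonal.normSq * (C c₀ * (-(C ((8 * (m : ℝ) + 14) * ((m : ℝ) + 2) * g₁) * L ^ (m + 1) * Zonal.detP L (Zonal.lapP G₂))
          + C ((8 * (n : ℝ) + 14) * ((n : ℝ) + 2) * g₂) * L ^ (n + 1) * Zonal.detP L (Zonal.lapP G₁)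
          + C ((8 * (m : ℝ) + 14) * (8 * (n : ℝ) + 14)) * Zonal.detP G₁ G₂)
        + C ((8 * (m : ℝ) + 14) * (8 * (n : ℝ) + 14)) * (C cb * Zonal.detP Pb (P D) + C e * Zonal.detP Pc (P D'))
        + Zonal.normSq * (C ((8 * (m : ℝ) + 14) * (8 * (n : ℝ) + 14)) * R))) = 0 := by
    simp only [map_mul] at hE h2 ⊢
    linear_combination (C (8 * (m : ℝ) + 14) * C (8 * (n : ℝ) + 14)) * hE - C c₀ * h2
  have hE1 := (mul_eq_zero.mp hcomb1).resolve_left hρ0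
  -- the brackets of the competitor and of the `D′ − 4` shell with the top shell, to first order
  have hPcD := Zonal.detP_genShell_right ra rb rd re rf Pc hPDeq
  have hPbD := Zonal.detP_genShell_right ra rb rd re rf Pb hPDeq
  simp only [← hLdef] at hPcD hPbD
  -- `X := u·P_c − κ₁·L^m M` has vanishing null-cone bracket with `L`
  obtain ⟨u, hu⟩ : ∃ u : ℝ, u = c₁ * ((8 * (m : ℝ) + 14) * (8 * (n : ℝ) + 14)) * (g₂ * ((n : ℝ) + 2)) := ⟨_, rfl⟩
  obtain ⟨κ₁, hκ₁⟩ : ∃ κ₁ : ℝ, κ₁ = 24 * c₀ * ((m : ℝ) + 2) * ((n : ℝ) + 2) * ((m : ℝ) - n) * g₁ * g₂ := ⟨_, rfl⟩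
  have hu0 : u ≠ 0 := by
    have h1 : (8 * (m : ℝ) + 14) * (8 * (n : ℝ) + 14) ≠ 0 := by positivity
    have h2 : (g₂ * ((n : ℝ) + 2)) ≠ 0 := mul_ne_zero hg₂0 (by positivity)
    rw [hu]; exact mul_ne_zero (mul_ne_zero hc₁0 h1) h2
  set Xc : Zonal.RPoly := C u * Pc - C κ₁ * L ^ m * M with hXc
  have hXch : Xc.IsHomogeneous (2 * (m + 1)) := by
    refine (hPch.C_mul u).sub ?_
    have : (L ^ m * M).IsHomogeneous (2 * (m + 1)) := by
      have h := ((Zonal.isHomogeneous_genL ra rb rd re rf).pow m).mul (Zonal.isHomogeneous_genM ra rb rd re rf)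
      rwa [show 2 * m + 2 = 2 * (m + 1) by ring] at h
    simpa [mul_assoc] using this.C_mul κ₁
  have hXcL : L ^ (n + 1) * Zonal.detP Xc L + Zonal.normSq * (C (c₁ * ((8 * (m : ℝ) + 14) * (8 * (n : ℝ) + 14))) * Zonal.detP Pc G₂
      + (C c₀ * (-(C ((8 * (m : ℝ) + 14) * ((m : ℝ) + 2) * g₁) * L ^ (m + 1) * Zonal.detP L (Zonal.lapP G₂))
          + C ((8 * (n : ℝ) + 14) * ((n : ℝ) + 2) * g₂) * L ^ (n + 1) * Zonal.detP L (Zonal.lapP G₁)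
          + C ((8 * (m : ℝ) + 14) * (8 * (n : ℝ) + 14)) * Zonal.detP G₁ G₂)
        + C ((8 * (m : ℝ) + 14) * (8 * (n : ℝ) + 14)) * (C cb * Zonal.detP Pb (P D) + C e * Zonal.detP Pc (P D'))
        + Zonal.normSq * (C ((8 * (m : ℝ) + 14) * (8 * (n : ℝ) + 14)) * R))) = 0 := by
    have hLM : Zonal.detP (L ^ m * M) L = -(C 4 * L ^ m * W) := by
      rw [hLdef, hMdef, hWdef]; exact Zonal.detP_genL_pow_mul_genM_genL ra rb rd re rf m
    have hX1 : Zonal.detP Xc L = C u * Zonal.detP Pc L + C (4 * κ₁) * L ^ m * W := by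
      rw [hXc, Zonal.detP_sub_left, Zonal.detP_C_mul_left, show C κ₁ * L ^ m * M = C κ₁ * (L ^ m * M) by ring,
        Zonal.detP_C_mul_left, hLM]
      simp only [map_mul, map_ofNat]; ring
    rw [hX1, hu, hκ₁]
    rw [hPcD] at hE1
    simp only [map_mul, map_add, map_sub, map_ofNat, map_natCast] at hE1 ⊢
    linear_combination hE1
  have hXchart : Zonal.chartT (map (algebraMap ℝ ℂ) (Zonal.detP Xc L)) = 0 := by
    have h1 := congrArg (fun p : Zonal.RPoly => Zonal.chartT (map (algebraMap ℝ ℂ) p)) hXcL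
    simp only [map_add, map_mul, map_pow, Zonal.map_normSq, Zonal.chartT_add, Zonal.chartT_mul, Zonal.chartT_pow,
      Zonal.chartT_normSq, zero_mul, add_zero, map_zero, Zonal.chartT_zero] at h1
    exact (mul_eq_zero.mp h1).resolve_left (pow_ne_zero _ hLc)
  obtain ⟨κ₀, Gc, hGc, hXeq⟩ := Zonal.exists_eq_C_mul_pow_add_of_chartT_detP_genL hXch (by omega) hL0
    (by rw [hLdef] at hXchart; exact hXchart)
  have hGc' : Gc.IsHomogeneous (2 * m) := by rw [show 2 * m = 2 * (m + 1) - 2 by omega]; exact hGc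
  -- the confined competitor `P_c′ := u·P_c = κ₀L^{m+1} + κ₁L^m M + ρG_c`
  set Pc' : Zonal.RPoly := C u * Pc with hPc'
  have hPc'eq : Pc' = C κ₀ * L ^ (m + 1) + C κ₁ * L ^ m * M + Zonal.normSq * Gc := by
    rw [hPc', show C u * Pc = Xc + C κ₁ * L ^ m * M by rw [hXc]; ring, hXeq]; ring
  have hPc'l : Zonal.lapP Pc' = 0 := by rw [hPc', Zonal.lapP_C_mul, hPcl, mul_zero]
  -- cancel the second `ρ`
  have hE2 : L ^ (n + 1) * Zonal.detP Gc L + (C (c₁ * ((8 * (m : ℝ) + 14) * (8 * (n : ℝ) + 14))) * Zonal.detP Pc G₂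
      + (C c₀ * (-(C ((8 * (m : ℝ) + 14) * ((m : ℝ) + 2) * g₁) * L ^ (m + 1) * Zonal.detP L (Zonal.lapP G₂))
          + C ((8 * (n : ℝ) + 14) * ((n : ℝ) + 2) * g₂) * L ^ (n + 1) * Zonal.detP L (Zonal.lapP G₁)
          + C ((8 * (m : ℝ) + 14) * (8 * (n : ℝ) + 14)) * Zonal.detP G₁ G₂)
        + C ((8 * (m : ℝ) + 14) * (8 * (n : ℝ) + 14)) * (C cb * Zonal.detP Pb (P D) + C e * Zonal.detP Pc (P D'))
        + Zonal.normSq * (C ((8 * (m : ℝ) + 14) * (8 * (n : ℝ) + 14)) * R))) = 0 := by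
    have hX2 : Zonal.detP Xc L = Zonal.normSq * Zonal.detP Gc L := by
      rw [hXeq, Zonal.detP_add_left, Zonal.detP_C_mul_left, hLdef, Zonal.detP_genL_pow_genL, Zonal.detP_normSq_mul_genL,
        mul_zero, zero_add]
    rw [hX2] at hXcL
    have h1 : Zonal.normSq * (L ^ (n + 1) * Zonal.detP Gc L + (C (c₁ * ((8 * (m : ℝ) + 14) * (8 * (n : ℝ) + 14))) * Zonal.detP Pc G₂
      + (C c₀ * (-(C ((8 * (m : ℝ) + 14) * ((m : ℝ) + 2) * g₁) * L ^ (m + 1) * Zonal.detP L (Zonal.lapP G₂))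
          + C ((8 * (n : ℝ) + 14) * ((n : ℝ) + 2) * g₂) * L ^ (n + 1) * Zonal.detP L (Zonal.lapP G₁)
          + C ((8 * (m : ℝ) + 14) * (8 * (n : ℝ) + 14)) * Zonal.detP G₁ G₂)
        + C ((8 * (m : ℝ) + 14) * (8 * (n : ℝ) + 14)) * (C cb * Zonal.detP Pb (P D) + C e * Zonal.detP Pc (P D'))
        + Zonal.normSq * (C ((8 * (m : ℝ) + 14) * (8 * (n : ℝ) + 14)) * R)))) = 0 := by
      linear_combination hXcL
    exact (mul_eq_zero.mp h1).resolve_left hρ0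
  -- (5) DIGIT 3: every bracket modulo `ρ`, denominators cleared, multiplied by `L²`
  obtain ⟨J₁, hT1⟩ := Zonal.exists_detP_genL_competitorRemainder ra rb rd re rf hGc' hPc'eq hPc'l
  obtain ⟨J₂, hT2⟩ := Zonal.exists_detP_competitor_remainder ra rb rd re rf (n := n) hPc'eq hr₂'
  obtain ⟨J₃, hG1r⟩ := Zonal.exists_detP_genL_lapP_remainder ra rb rd re rf hG₁' hr₁'
  obtain ⟨J₄, hG2r⟩ := Zonal.exists_detP_genL_lapP_remainder ra rb rd re rf hG₂' hr₂'
  obtain ⟨J₅, hG12⟩ := Zonal.exists_detP_remainders ra rb rd re rf hr₁' hr₂'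
  obtain ⟨J₆, hT5⟩ := Zonal.exists_detP_competitor_top ra rb rd re rf hPc'eq hPD'eq
  simp only [← hLdef, ← hMdef, ← hWdef] at hT1 hT2 hG1r hG2r hG12 hT5
  have hPc'G : Zonal.detP Pc' G₂ = C u * Zonal.detP Pc G₂ := by rw [hPc', Zonal.detP_C_mul_left]
  have hPc'D' : Zonal.detP Pc' (P D') = C u * Zonal.detP Pc (P D') := by rw [hPc', Zonal.detP_C_mul_left]
  rw [hPc'G] at hT2
  rw [hPc'D'] at hT5
  have hPbZ' := hPbZ L
  -- the `(c, D′)` pair is on level `N − 4` only when `n = m + 1`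
  obtain ⟨Ze, heZ⟩ : ∃ Ze : ℝ, C e * L ^ (2 * m + 3) = C Ze * L ^ (m + n + 2) := by
    by_cases hnm : n = m + 1
    · exact ⟨e, by rw [show 2 * m + 3 = m + n + 2 by omega]⟩
    · refine ⟨0, ?_⟩
      rw [he (by omega), map_zero, zero_mul, zero_mul]
  -- the digit-3 coefficient (`q₁ = 8m+14`, `q₂ = 8n+14`, `d₁ = 8m+6`, `f₁ = 16m+20`, `f₂ = 16n+20`, `A_i` the remainder constants)
  obtain ⟨KM, hKM⟩ : ∃ KM : ℝ, KM = u * (8 * (n : ℝ) + 14) * (16 * (m : ℝ) + 20) * (16 * (n : ℝ) + 20) * (32 * (m : ℝ) * ((m : ℝ) - 1) * κ₁)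
      + c₁ * ((8 * (m : ℝ) + 14) * (8 * (n : ℝ) + 14)) * (8 * (m : ℝ) + 6) * (16 * (m : ℝ) + 20) * (16 * (n : ℝ) + 20)
        * (4 * ((m : ℝ) - n) * κ₁ * (-(4 * ((n : ℝ) + 2) * ((n : ℝ) + 1) * g₂)))
      + c₀ * u * (8 * (n : ℝ) + 14) * (8 * (m : ℝ) + 6)
        * (-((8 * (m : ℝ) + 14) * ((m : ℝ) + 2) * g₁) * (16 * (m : ℝ) + 20)
            * (32 * (-(4 * ((n : ℝ) + 2) * ((n : ℝ) + 1) * g₂)) * (n : ℝ) * ((n : ℝ) - 1))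
          + ((8 * (n : ℝ) + 14) * ((n : ℝ) + 2) * g₂) * (16 * (n : ℝ) + 20)
            * (32 * (-(4 * ((m : ℝ) + 2) * ((m : ℝ) + 1) * g₁)) * (m : ℝ) * ((m : ℝ) - 1))
          + (16 * (m : ℝ) + 20) * (16 * (n : ℝ) + 20)
            * (4 * ((m : ℝ) - n) * (-(4 * ((m : ℝ) + 2) * ((m : ℝ) + 1) * g₁)) * (-(4 * ((n : ℝ) + 2) * ((n : ℝ) + 1) * g₂)))) := ⟨_, rfl⟩
  -- ★ its closed form: `K_M = 4096·c₀c₁q₁q₂(m+2)(n+2)²·g₁g₂²·N(m,n)`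
  have hKMfac : KM = 4096 * c₀ * c₁ * ((8 * (m : ℝ) + 14) * (8 * (n : ℝ) + 14)) * ((m : ℝ) + 2) * ((n : ℝ) + 2) ^ 2 * g₁ * g₂ ^ 2
      * (144 * (m : ℝ) ^ 4 * n + 180 * (m : ℝ) ^ 4 + 612 * (m : ℝ) ^ 3 * n + 675 * (m : ℝ) ^ 3 - 144 * (m : ℝ) ^ 2 * (n : ℝ) ^ 3
        - 180 * (m : ℝ) ^ 2 * (n : ℝ) ^ 2 + 1350 * (m : ℝ) ^ 2 * n + 1350 * (m : ℝ) ^ 2 - 612 * (m : ℝ) * (n : ℝ) ^ 3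
        - 1395 * (m : ℝ) * (n : ℝ) ^ 2 + 540 * (m : ℝ) * n + 1260 * (m : ℝ) - 630 * (n : ℝ) ^ 3 - 1890 * (n : ℝ) ^ 2 - 1260 * (n : ℝ)) := by
    rw [hKM, hu, hκ₁]; ring
  have hKM0 : KM ≠ 0 := by
    have h1 : (8 * (m : ℝ) + 14) * (8 * (n : ℝ) + 14) ≠ 0 := by positivity
    have h2 : ((m : ℝ) + 2) ≠ 0 := by positivity
    have h3 : ((n : ℝ) + 2) ^ 2 ≠ 0 := by positivity
    rw [hKMfac]
    exact mul_ne_zero (mul_ne_zero (mul_ne_zero (mul_ne_zero (mul_ne_zero (mul_ne_zero (mul_ne_zero (mul_ne_zero (by norm_num)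
      hc₀0) hc₁0) h1) h2) h3) hg₁0) (pow_ne_zero 2 hg₂0)) (Zonal.thirdDigit_numerator_ne_zero hmn)
  -- the `L²·(multiplier)` multiple of (E2), modulo `ρ`
  obtain ⟨zW, hzW⟩ : ∃ zW : ℝ, zW = u * (8 * (n : ℝ) + 14) * (16 * (m : ℝ) + 20) * (16 * (n : ℝ) + 20) * (16 * ((m : ℝ) + 1) * m * κ₀)
      + c₁ * ((8 * (m : ℝ) + 14) * (8 * (n : ℝ) + 14)) * (8 * (m : ℝ) + 6) * (16 * (m : ℝ) + 20) * (16 * (n : ℝ) + 20)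
        * (4 * ((m : ℝ) + 1) * κ₀ * (-(4 * ((n : ℝ) + 2) * ((n : ℝ) + 1) * g₂)))
      - ((8 * (m : ℝ) + 14) * (8 * (n : ℝ) + 14)) * Ze * (8 * (n : ℝ) + 14) * (8 * (m : ℝ) + 6) * (16 * (m : ℝ) + 20)
        * (16 * (n : ℝ) + 20) * (4 * ((m : ℝ) + 2) * κ₁ * g₁) := ⟨_, rfl⟩
  obtain ⟨zb, hzb⟩ : ∃ zb : ℝ, zb = ((8 * (m : ℝ) + 14) * (8 * (n : ℝ) + 14)) * cb * u * (8 * (n : ℝ) + 14) * (8 * (m : ℝ) + 6)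
      * (16 * (m : ℝ) + 20) * (16 * (n : ℝ) + 20) * (g₂ * ((n : ℝ) + 2)) := ⟨_, rfl⟩
  -- the three scalars with `C` pushed through
  have hKM' : C KM = C u * (8 * (n : Zonal.RPoly) + 14) * (16 * (m : Zonal.RPoly) + 20) * (16 * (n : Zonal.RPoly) + 20) * (32 * (m : Zonal.RPoly) * ((m : Zonal.RPoly) - 1) * C κ₁)
      + C c₁ * ((8 * (m : Zonal.RPoly) + 14) * (8 * (n : Zonal.RPoly) + 14)) * (8 * (m : Zonal.RPoly) + 6) * (16 * (m : Zonal.RPoly) + 20) * (16 * (n : Zonal.RPoly) + 20) * (4 * ((m : Zonal.RPoly) - (n : Zonal.RPoly)) * C κ₁ * (-(4 * ((n : Zonal.RPoly) + 2) * ((n : Zonal.RPoly) + 1) * C g₂)))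
      + C c₀ * C u * (8 * (n : Zonal.RPoly) + 14) * (8 * (m : Zonal.RPoly) + 6)
        * (-((8 * (m : Zonal.RPoly) + 14) * ((m : Zonal.RPoly) + 2) * C g₁) * (16 * (m : Zonal.RPoly) + 20) * (32 * (-(4 * ((n : Zonal.RPoly) + 2) * ((n : Zonal.RPoly) + 1) * C g₂)) * (n : Zonal.RPoly) * ((n : Zonal.RPoly) - 1))
          + ((8 * (n : Zonal.RPoly) + 14) * ((n : Zonal.RPoly) + 2) * C g₂) * (16 * (n : Zonal.RPoly) + 20) * (32 * (-(4 * ((m : Zonal.RPoly) + 2) * ((m : Zonal.RPoly) + 1) * C g₁)) * (m : Zonal.RPoly) * ((m : Zonal.RPoly) - 1))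
          + (16 * (m : Zonal.RPoly) + 20) * (16 * (n : Zonal.RPoly) + 20) * (4 * ((m : Zonal.RPoly) - (n : Zonal.RPoly)) * (-(4 * ((m : Zonal.RPoly) + 2) * ((m : Zonal.RPoly) + 1) * C g₁)) * (-(4 * ((n : Zonal.RPoly) + 2) * ((n : Zonal.RPoly) + 1) * C g₂)))) := by
    rw [hKM]; simp only [map_mul, map_add, map_sub, map_neg, map_ofNat, map_natCast, map_one]
  have hzW' : C zW = C u * (8 * (n : Zonal.RPoly) + 14) * (16 * (m : Zonal.RPoly) + 20) * (16 * (n : Zonal.RPoly) + 20) * (16 * ((m : Zonal.RPoly) + 1) * (m : Zonal.RPoly) * C κ₀)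
      + C c₁ * ((8 * (m : Zonal.RPoly) + 14) * (8 * (n : Zonal.RPoly) + 14)) * (8 * (m : Zonal.RPoly) + 6) * (16 * (m : Zonal.RPoly) + 20) * (16 * (n : Zonal.RPoly) + 20) * (4 * ((m : Zonal.RPoly) + 1) * C κ₀ * (-(4 * ((n : Zonal.RPoly) + 2) * ((n : Zonal.RPoly) + 1) * C g₂)))
      - ((8 * (m : Zonal.RPoly) + 14) * (8 * (n : Zonal.RPoly) + 14)) * C Ze * (8 * (n : Zonal.RPoly) + 14) * (8 * (m : Zonal.RPoly) + 6) * (16 * (m : Zonal.RPoly) + 20) * (16 * (n : Zonal.RPoly) + 20) * (4 * ((m : Zonal.RPoly) + 2) * C κ₁ * C g₁) := by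
    rw [hzW]; simp only [map_mul, map_add, map_sub, map_neg, map_ofNat, map_natCast, map_one]
  have hzb' : C zb = ((8 * (m : Zonal.RPoly) + 14) * (8 * (n : Zonal.RPoly) + 14)) * C cb * C u * (8 * (n : Zonal.RPoly) + 14) * (8 * (m : Zonal.RPoly) + 6) * (16 * (m : Zonal.RPoly) + 20) * (16 * (n : Zonal.RPoly) + 20) * (C g₂ * ((n : Zonal.RPoly) + 2)) := by
    rw [hzb]; simp only [map_mul, map_add, map_ofNat, map_natCast]
  have hE3 : ∃ J : Zonal.RPoly, C KM * L ^ (m + n + 1) * M * W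
      + L ^ (m + n + 2) * (C zW * W + C zb * (if m = 1 then Zonal.detP Pb L else 0)) + Zonal.normSq * J = 0 := by
    refine ⟨C u * (8 * (n : Zonal.RPoly) + 14) * (8 * (m : Zonal.RPoly) + 6) * (16 * (m : Zonal.RPoly) + 20) * (16 * (n : Zonal.RPoly) + 20) * ((8 * (m : Zonal.RPoly) + 14) * (8 * (n : Zonal.RPoly) + 14)) * L ^ 2 * R
      + C u * (8 * (n : Zonal.RPoly) + 14) * (16 * (m : Zonal.RPoly) + 20) * (16 * (n : Zonal.RPoly) + 20) * L ^ (n + 1) * J₁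
      + C c₁ * ((8 * (m : Zonal.RPoly) + 14) * (8 * (n : Zonal.RPoly) + 14)) * (8 * (m : Zonal.RPoly) + 6) * (16 * (m : Zonal.RPoly) + 20) * (16 * (n : Zonal.RPoly) + 20) * J₂
      + C c₀ * C u * (8 * (n : Zonal.RPoly) + 14) * (8 * (m : Zonal.RPoly) + 6) * (16 * (m : Zonal.RPoly) + 20) * (-((8 * (m : Zonal.RPoly) + 14) * ((m : Zonal.RPoly) + 2) * C g₁)) * L ^ (m + 1) * J₄
      + C c₀ * C u * (8 * (n : Zonal.RPoly) + 14) * (8 * (m : Zonal.RPoly) + 6) * (16 * (n : Zonal.RPoly) + 20) * ((8 * (n : Zonal.RPoly) + 14) * ((n : Zonal.RPoly) + 2) * C g₂) * L ^ (n + 1) * J₃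
      + C c₀ * C u * (8 * (n : Zonal.RPoly) + 14) * (8 * (m : Zonal.RPoly) + 6) * (16 * (m : Zonal.RPoly) + 20) * (16 * (n : Zonal.RPoly) + 20) * J₅
      + ((8 * (m : Zonal.RPoly) + 14) * (8 * (n : Zonal.RPoly) + 14)) * C cb * C u * (8 * (n : Zonal.RPoly) + 14) * (8 * (m : Zonal.RPoly) + 6) * (16 * (m : Zonal.RPoly) + 20) * (16 * (n : Zonal.RPoly) + 20) * L ^ 2 * Zonal.detP Pb G₂
      + ((8 * (m : Zonal.RPoly) + 14) * (8 * (n : Zonal.RPoly) + 14)) * C e * (8 * (n : Zonal.RPoly) + 14) * (8 * (m : Zonal.RPoly) + 6) * (16 * (m : Zonal.RPoly) + 20) * (16 * (n : Zonal.RPoly) + 20) * L ^ 2 * J₆, ?_⟩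
    rw [hPbD] at hE2
    rw [hKM', hzW', hzb']
    simp only [map_mul, map_add, map_ofNat, map_natCast] at hE2
    simp only [map_mul, map_add, map_sub, map_ofNat, map_natCast, map_one] at hT1
    simp only [map_mul, map_add, map_sub, map_neg, map_ofNat, map_natCast, map_one] at hT2
    simp only [map_mul, map_add, map_sub, map_neg, map_ofNat, map_natCast, map_one] at hG1r hG2r hG12
    simp only [map_mul, map_add, map_ofNat, map_natCast, map_one] at hT5
    linear_combination C u * (8 * (n : Zonal.RPoly) + 14) * (8 * (m : Zonal.RPoly) + 6) * (16 * (m : Zonal.RPoly) + 20) * (16 * (n : Zonal.RPoly) + 20) * L ^ 2 * hE2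
      - C u * (8 * (n : Zonal.RPoly) + 14) * (16 * (m : Zonal.RPoly) + 20) * (16 * (n : Zonal.RPoly) + 20) * L ^ (n + 1) * hT1
      - C c₁ * ((8 * (m : Zonal.RPoly) + 14) * (8 * (n : Zonal.RPoly) + 14)) * (8 * (m : Zonal.RPoly) + 6) * (16 * (m : Zonal.RPoly) + 20) * (16 * (n : Zonal.RPoly) + 20) * hT2
      + C c₀ * C u * (8 * (n : Zonal.RPoly) + 14) * (8 * (m : Zonal.RPoly) + 6) * (16 * (m : Zonal.RPoly) + 20) * ((8 * (m : Zonal.RPoly) + 14) * ((m : Zonal.RPoly) + 2) * C g₁) * L ^ (m + 1) * hG2r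
      - C c₀ * C u * (8 * (n : Zonal.RPoly) + 14) * (8 * (m : Zonal.RPoly) + 6) * (16 * (n : Zonal.RPoly) + 20) * ((8 * (n : Zonal.RPoly) + 14) * ((n : Zonal.RPoly) + 2) * C g₂) * L ^ (n + 1) * hG1r
      - C c₀ * C u * (8 * (n : Zonal.RPoly) + 14) * (8 * (m : Zonal.RPoly) + 6) * (16 * (m : Zonal.RPoly) + 20) * (16 * (n : Zonal.RPoly) + 20) * hG12
      - ((8 * (m : Zonal.RPoly) + 14) * (8 * (n : Zonal.RPoly) + 14)) * C cb * C u * (8 * (n : Zonal.RPoly) + 14) * (8 * (m : Zonal.RPoly) + 6) * (16 * (m : Zonal.RPoly) + 20) * (16 * (n : Zonal.RPoly) + 20) * (C g₂ * ((n : Zonal.RPoly) + 2)) * hPbZ'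
      - ((8 * (m : Zonal.RPoly) + 14) * (8 * (n : Zonal.RPoly) + 14)) * C e * (8 * (n : Zonal.RPoly) + 14) * (8 * (m : Zonal.RPoly) + 6) * (16 * (m : Zonal.RPoly) + 20) * (16 * (n : Zonal.RPoly) + 20) * L ^ 2 * hT5
      + ((8 * (m : Zonal.RPoly) + 14) * (8 * (n : Zonal.RPoly) + 14)) * (8 * (n : Zonal.RPoly) + 14) * (8 * (m : Zonal.RPoly) + 6) * (16 * (m : Zonal.RPoly) + 20) * (16 * (n : Zonal.RPoly) + 20) * (4 * ((m : Zonal.RPoly) + 2) * C κ₁ * C g₁) * W * heZ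
  obtain ⟨J, hJ⟩ := hE3
  -- (6) the chart: `chartT L ∣ K_M · chartT W · chartT M`
  suffices hW0 : W = 0 from
    exists_axis_of_genW_eq_zero ra rb rd re rf hL0 (by rw [hWdef] at hW0; exact hW0) hPDh hPDl (hK D hD) hDdef g₂
      (by rw [← hLdef]; exact hchartPD)
  by_contra hW0
  have h1 := congrArg (fun p : Zonal.RPoly => Zonal.chartT (map (algebraMap ℝ ℂ) p)) hJ
  simp only [map_add, map_mul, map_pow, Zonal.map_normSq, Zonal.chartT_add, Zonal.chartT_mul, Zonal.chartT_pow, Zonal.chartT_normSq,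
    zero_mul, add_zero, map_zero, Zonal.chartT_zero, map_C, Zonal.chartT_C] at h1
  set Zhat : ℂ[X] := Polynomial.C ((algebraMap ℝ ℂ) zW) * Zonal.chartT (map (algebraMap ℝ ℂ) W)
    + Polynomial.C ((algebraMap ℝ ℂ) zb) * Zonal.chartT (map (algebraMap ℝ ℂ) (if m = 1 then Zonal.detP Pb L else 0)) with hZhat
  have h2 : Zonal.chartT (map (algebraMap ℝ ℂ) L) ^ (m + n + 1)
      * (Polynomial.C ((algebraMap ℝ ℂ) KM) * (Zonal.chartT (map (algebraMap ℝ ℂ) W) * Zonal.chartT (map (algebraMap ℝ ℂ) M))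
        + Zonal.chartT (map (algebraMap ℝ ℂ) L) * Zhat) = 0 := by
    rw [hZhat]; linear_combination h1
  have h3 := (mul_eq_zero.mp h2).resolve_left (pow_ne_zero _ hLc)
  have hdvd : Zonal.chartT (map (algebraMap ℝ ℂ) (Zonal.genL ra rb rd re rf))
      ∣ Polynomial.C ((algebraMap ℝ ℂ) KM) * (Zonal.chartT (map (algebraMap ℝ ℂ) (Zonal.genW ra rb rd re rf))
        * Zonal.chartT (map (algebraMap ℝ ℂ) (Zonal.genM ra rb rd re rf))) :=
    ⟨-Zhat, by rw [← hLdef, ← hMdef, ← hWdef]; linear_combination h3⟩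
  have hk := Zonal.eq_zero_of_chartT_genL_dvd ra rb rd re rf hW0 hdvd
  exact hKM0 (by simpa using hk)

end FiniteTower

end Summit.NavierStokesRegularity.NavierStokesRegularity.Theorems.PoloidalLiouville.HorizonTower

end
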